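import Mathlib.MeasureTheory.Measure.Lebesgue.VolumeOfBalls
import Mathlib.MeasureTheory.Integral.Bochner.Set
import Literature.Analysis.FluidPDE.ClassicalSolution
import Literature.Analysis.FluidPDE.ClassicalSolutionCalculus
import Literature.Analysis.FluidPDE.RapidDecayLemmas
import Literature.Analysis.FluidPDE.DriftHeatLocalClass
import HarnessLib

/-!
# Route SelfMixingDichotomy — crux `MixingPayoff`, line `birth`: the Type-I floor assembly (F)

Support file (`--supports stmt-NavierStokesRegularity-1422`) for the crux
`Summit.NavierStokesRegularity.NavierStokesRegularity.Theses.SelfMixingDichotomy.MixingPayoff`,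
line `birth`, stub `stub_typeIFloorAssembly` (F: the bounded-drift floor under a Type-I bound,
glued from the three landed pieces F1 `stub_admissibleDriftHeatClass`, F2
`stub_admissibleMinPrinciple`, F3 `stub_driftHeatBumpFloor`).

**Statement.** The implication `F1-sig → F2-sig → F3-sig → F-sig`, where F-sig says: for every
`K > 0` there is `c₁ = c₁(K) > 0` such that at a point `(T, x₀)` where a classical solution `u`
on `[0, T)` obeys the Type-I(K) bound `√(T − t) ‖u t x‖ ≤ K` on `(T − r₁², T) × B(x₀, r₁)`,
for all small `r` every MIX-admissible scalar `θ` on the window `S = [T − r², T − r²/2]`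
(jointly smooth, uniformly rapidly decaying, solving `∂ₜθ + ⟪u, ∇θ⟫ = Δθ`) with bump datum
(`0 ≤ θ₀ ≤ 1`, `θ₀ = 1` on `B̄(x₀, r/2)`, `supp θ₀ ⊆ B(x₀, r)`) keeps strictly more than the
fraction `c₁²` of its `L²` mass.

**Proof.** Take `c₁ = λ(K)/3` with `λ(K)` from F3 and `r₂ = min (r₁/(4 + 8K)) √T`. For
`0 < r < r₂`: `r² < T`, so `S ⊆ [0, T)` and `u` is continuous on `S × ℝ³`; on `S` one has
`T − t ≥ r²/2` and `t ∈ (T − r₁², T)`, so the Type-I bound gives the drift bound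
`‖u‖ ≤ √2 K / r` on `S × B(x₀, r₁)`. F1 puts `θ` in the local drift–heat class over
`U = B(x₀, r₁) ⊇ B̄(x₀, (3 + 8K) r)`, F2 gives `θ ≥ 0` on `S × ℝ³`, and F3 gives
`θ(T − r²/2) ≥ λ` on `B̄(x₀, r/2)`. The slice `θ(T − r²/2)²` is integrable (uniform rapid
decay of order zero, weight `(1 + ‖x‖)^{-4}`, `4 > 3`), so
`∫ θ(T − r²/2)² ≥ λ² |B̄(x₀, r/2)| = λ² |B₁| r³/8 > (λ²/9) |B₁| r³ ≥ c₁² ∫ θ(T − r²)²`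
(`θ(T − r²)² ≤ 𝟙_{B(x₀, r)}`).

No named fact is taken as a hypothesis beyond the three premises, which are the verbatim
signatures of the landed theorems F1, F2, F3 of this namespace.
-/

noncomputable section

open Literature.Analysis.FluidPDE MeasureTheory Set Function Metric
open scoped ContDiff

-- `Summit = Problem` for this summit; the tree lakefile sets `weak.linter.dupNamespace = false`,
-- made explicit here for out-of-tree `lean check`.
set_option linter.dupNamespace false

namespace Summit.NavierStokesRegularity.NavierStokesRegularity.Theorems

local notation "E3" => EuclideanSpace ℝ (Fin 3)

/-! ### Elementary pieces of the assembly -/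

/-- **The drift bound on the window.** If `√(T − t) ‖v‖ ≤ K` and `r²/2 ≤ T − t` with `0 < r`,
then `‖v‖ ≤ √2 K / r` (`r ≤ √2 √(T − t)`). -/
theorem typeIFloor_norm_le_of_typeI {K T t r : ℝ} {v : E3} (hr : 0 < r)
    (hTt : r ^ 2 / 2 ≤ T - t) (hK : Real.sqrt (T - t) * ‖v‖ ≤ K) :
    ‖v‖ ≤ Real.sqrt 2 * K / r := by
  have hsqrt : r ≤ Real.sqrt 2 * Real.sqrt (T - t) :=
    calc r = Real.sqrt (r ^ 2) := (Real.sqrt_sq hr.le).symm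
      _ ≤ Real.sqrt (2 * (T - t)) := Real.sqrt_le_sqrt (by linarith)
      _ = Real.sqrt 2 * Real.sqrt (T - t) := Real.sqrt_mul (by norm_num) _
  rw [le_div_iff₀ hr]
  calc ‖v‖ * r ≤ ‖v‖ * (Real.sqrt 2 * Real.sqrt (T - t)) :=
        mul_le_mul_of_nonneg_left hsqrt (norm_nonneg _)
    _ = Real.sqrt 2 * (Real.sqrt (T - t) * ‖v‖) := by ring
    _ ≤ Real.sqrt 2 * K := mul_le_mul_of_nonneg_left hK (Real.sqrt_nonneg _)

/-- **Integrability of the squared slice of a uniformly rapidly decaying field.** For `θ` jointly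
smooth on `S × ℝ³` with uniform rapid decay and `t ∈ S`, `x ↦ (θ t x)²` is integrable: the
order-zero decay bound `|θ t x| ≤ C (1 + ‖x‖)^{-4}` gives `(θ t x)² ≤ C² (1 + ‖x‖)^{-4}` and
`4 > 3 = dim`. -/
theorem typeIFloor_integrable_sq_slice {S : Set ℝ} {θ : ℝ → E3 → ℝ}
    (hsm : IsSmoothSpaceTimeOn S θ) (hdec : HasUniformRapidDecayOn S θ) {t : ℝ} (ht : t ∈ S) :
    Integrable (fun x => (θ t x) ^ 2) := by
  obtain ⟨C, hC0, hC⟩ := hdec.norm_le_rpow 4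
  refine integrable_of_norm_le_rpow_neg ((hsm.continuous_slice ht).pow 2) (C := C * C)
    (r := 4) ?_ ?_
  · rw [finrank_euclideanSpace_fin]
    norm_num
  · intro x
    have h1 : ‖θ t x‖ ≤ C * (1 + ‖x‖) ^ (-(4 : ℝ)) := by exact_mod_cast hC t ht x
    have hw1 : (1 + ‖x‖) ^ (-(4 : ℝ)) ≤ 1 := rpow_neg_le_one x (by norm_num)
    have hw0 : 0 ≤ (1 + ‖x‖) ^ (-(4 : ℝ)) := by positivity
    have h2 : ‖θ t x‖ ≤ C := h1.trans (by nlinarith)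
    rw [norm_pow]
    calc ‖θ t x‖ ^ 2 = ‖θ t x‖ * ‖θ t x‖ := sq _
      _ ≤ C * (C * (1 + ‖x‖) ^ (-(4 : ℝ))) := mul_le_mul h2 h1 (norm_nonneg _) hC0
      _ = C * C * (1 + ‖x‖) ^ (-(4 : ℝ)) := by ring

/-- **Upper bound for the mass of a bump datum.** If `0 ≤ θ₀ ≤ 1` and `supp θ₀ ⊆ B(x₀, r)`
(`0 ≤ r`), then `∫ θ₀² ≤ |B(x₀, r)| = r³ |B₁|`. -/
theorem typeIFloor_integral_sq_le_of_bump {θ₀ : E3 → ℝ} {x₀ : E3} {r : ℝ} (hr : 0 ≤ r)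
    (h0 : ∀ x, 0 ≤ θ₀ x) (h1 : ∀ x, θ₀ x ≤ 1) (hsupp : Function.support θ₀ ⊆ Metric.ball x₀ r) :
    ∫ x, (θ₀ x) ^ 2 ≤ r ^ 3 * (volume : Measure E3).real (Metric.ball (0 : E3) 1) := by
  have hind : ∀ x, (θ₀ x) ^ 2 ≤ (ball x₀ r).indicator (fun _ => (1 : ℝ)) x := by
    intro x
    by_cases hx : x ∈ ball x₀ r
    · rw [indicator_of_mem hx]
      have := h0 x
      have := h1 x
      nlinarith
    · rw [indicator_of_notMem hx]
      have hz : θ₀ x = 0 := by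
        by_contra h
        exact hx (hsupp (Function.mem_support.2 h))
      rw [hz]
      norm_num
  have hint : Integrable ((ball x₀ r).indicator fun _ => (1 : ℝ)) (volume : Measure E3) :=
    (integrableOn_const (measure_ball_lt_top (x := x₀) (r := r)).ne).integrable_indicator
      measurableSet_ball
  calc ∫ x, (θ₀ x) ^ 2 ≤ ∫ x, (ball x₀ r).indicator (fun _ => (1 : ℝ)) x :=
        integral_mono_of_nonneg (ae_of_all _ fun x => sq_nonneg _) hint (ae_of_all _ hind)
    _ = (volume : Measure E3).real (ball x₀ r) := by
        rw [integral_indicator_const _ measurableSet_ball, smul_eq_mul, mul_one]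
    _ = r ^ 3 * (volume : Measure E3).real (ball (0 : E3) 1) := by
        rw [← Measure.addHaar_real_closedBall_eq_addHaar_real_ball,
          Measure.addHaar_real_closedBall _ _ hr, finrank_euclideanSpace_fin]

/-- **Lower bound for the mass of a floored slice.** If `θ₁²` is integrable and `θ₁ ≥ λ ≥ 0` on
`B̄(x₀, r/2)` (`0 ≤ r`), then `λ² (r/2)³ |B₁| ≤ ∫ θ₁²`. -/
theorem typeIFloor_le_integral_sq_of_floor {θ₁ : E3 → ℝ} {x₀ : E3} {r lam : ℝ} (hr : 0 ≤ r)
    (hlam : 0 ≤ lam) (hint : Integrable (fun x => (θ₁ x) ^ 2))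
    (hlow : ∀ x ∈ Metric.closedBall x₀ (r / 2), lam ≤ θ₁ x) :
    lam ^ 2 * ((r / 2) ^ 3 * (volume : Measure E3).real (Metric.ball (0 : E3) 1)) ≤
      ∫ x, (θ₁ x) ^ 2 := by
  have hind : ∀ x, (closedBall x₀ (r / 2)).indicator (fun _ => lam ^ 2) x ≤ (θ₁ x) ^ 2 := by
    intro x
    by_cases hx : x ∈ closedBall x₀ (r / 2)
    · rw [indicator_of_mem hx]
      exact pow_le_pow_left₀ hlam (hlow x hx) 2
    · rw [indicator_of_notMem hx]
      exact sq_nonneg _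
  calc lam ^ 2 * ((r / 2) ^ 3 * (volume : Measure E3).real (ball (0 : E3) 1))
      = (volume : Measure E3).real (closedBall x₀ (r / 2)) * lam ^ 2 := by
        rw [Measure.addHaar_real_closedBall _ _ (by positivity : (0 : ℝ) ≤ r / 2),
          finrank_euclideanSpace_fin]
        ring
    _ = ∫ x, (closedBall x₀ (r / 2)).indicator (fun _ => lam ^ 2) x := by
        rw [integral_indicator_const _ measurableSet_closedBall, smul_eq_mul]
    _ ≤ ∫ x, (θ₁ x) ^ 2 :=
        integral_mono_of_nonneg
          (ae_of_all _ fun x => indicator_nonneg (fun _ _ => sq_nonneg lam) x) hint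
          (ae_of_all _ hind)

/-! ### The stub -/

/-- **Stub F (assembly) — the bounded-drift floor under a Type-I bound from the three pieces.**
From F1-sig (class bridge), F2-sig (minimum principle), F3-sig (Gaussian bump floor): for every
`K > 0` there is `c₁ = c₁(K) > 0` (`c₁ = λ(K)/3`) such that at a point `(T, x₀)` where a
classical solution on `[0,T)` obeys the Type-I(K) velocity bound on `(T - r₁², T) × B(x₀, r₁)`,
for all `r < r₂ := min (r₁/(4+8K)) √T` every MIX-admissible scalar with bump datum keeps
strictly more than the fraction `c₁²` of its `L²` mass: on the window `√(T−t) ≥ r/√2` gives the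
drift bound `√2 K / r` on `B(x₀, r₁)`; `u` is continuous on `S × ℝ³` (`S ⊆ [0,T)` as
`r² < T`); F1 gives class membership, F2 gives `θ ≥ 0`, F3 gives `θ(T − r²/2) ≥ λ` on
`B̄(x₀, r/2)`; `θ(T−r²/2)²` is integrable (uniform rapid decay), so
`∫ θ(T−r²/2)² ≥ λ² |B̄_{r/2}| = λ² |B₁| r³/8 > (λ²/9) |B₁| r³ ≥ c₁² ∫ θ(T−r²)²`
(`0 ≤ θ₀ ≤ 1`, `supp θ₀ ⊆ B_r`). -/
theorem stub_typeIFloorAssembly :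
    (∀ (T r : ℝ) (u : ℝ → E3 → E3) (θ : ℝ → E3 → ℝ), 0 < r →
      ContinuousOn (Function.uncurry u) (Set.Icc (T - r ^ 2) (T - r ^ 2 / 2) ×ˢ Set.univ) →
      IsSmoothSpaceTimeOn (Set.Icc (T - r ^ 2) (T - r ^ 2 / 2)) θ →
      (∀ t ∈ Set.Icc (T - r ^ 2) (T - r ^ 2 / 2), ∀ x : E3,
        timeDerivWithin (Set.Icc (T - r ^ 2) (T - r ^ 2 / 2)) θ t x + inner ℝ (u t x) (gradient (θ t) x)
          = Laplacian.laplacian (θ t) x) →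
      ∀ (A : ℝ) (U : Set E3), (∀ t ∈ Set.Icc (T - r ^ 2) (T - r ^ 2 / 2), ∀ x ∈ U, ‖u t x‖ ≤ A) →
      ∃ a : ℝ → E3 → E3, IsDriftHeatSolutionOn a θ A (Set.Icc (T - r ^ 2) (T - r ^ 2 / 2)) U) →
    (∀ (T r : ℝ) (u : ℝ → E3 → E3) (θ : ℝ → E3 → ℝ), 0 < r →
      IsSmoothSpaceTimeOn (Set.Icc (T - r ^ 2) (T - r ^ 2 / 2)) θ →
      HasUniformRapidDecayOn (Set.Icc (T - r ^ 2) (T - r ^ 2 / 2)) θ →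
      (∀ t ∈ Set.Icc (T - r ^ 2) (T - r ^ 2 / 2), ∀ x : E3,
        timeDerivWithin (Set.Icc (T - r ^ 2) (T - r ^ 2 / 2)) θ t x + inner ℝ (u t x) (gradient (θ t) x)
          = Laplacian.laplacian (θ t) x) →
      (∀ x : E3, 0 ≤ θ (T - r ^ 2) x) →
      ∀ t ∈ Set.Icc (T - r ^ 2) (T - r ^ 2 / 2), ∀ x : E3, 0 ≤ θ t x) →
    (∀ K : ℝ, 0 < K → ∃ lam : ℝ, 0 < lam ∧
      ∀ (a : ℝ → E3 → E3) (θ : ℝ → E3 → ℝ) (x₀ : E3) (T r : ℝ), 0 < r →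
      ∀ U : Set E3, IsOpen U → Metric.closedBall x₀ ((3 + 8 * K) * r) ⊆ U →
      IsDriftHeatSolutionOn a θ (Real.sqrt 2 * K / r) (Set.Icc (T - r ^ 2) (T - r ^ 2 / 2)) U →
      (∀ t ∈ Set.Icc (T - r ^ 2) (T - r ^ 2 / 2), ∀ x : E3, 0 ≤ θ t x) →
      (∀ x ∈ Metric.closedBall x₀ (r / 2), θ (T - r ^ 2) x = 1) →
      ∀ x ∈ Metric.closedBall x₀ (r / 2), lam ≤ θ (T - r ^ 2 / 2) x) →
    ∀ K : ℝ, 0 < K → ∃ c₁ : ℝ, 0 < c₁ ∧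
    ∀ (T : ℝ) (u : ℝ → E3 → E3) (p : ℝ → E3 → ℝ), 0 < T →
    IsClassicalNSSolutionOn (Set.Ico 0 T) 1 0 u p → ∀ x₀ : E3,
    (∃ r₁ : ℝ, 0 < r₁ ∧ ∀ t ∈ Set.Ioo (T - r₁ ^ 2) T, ∀ x ∈ Metric.ball x₀ r₁,
      Real.sqrt (T - t) * ‖u t x‖ ≤ K) →
    ∃ r₂ : ℝ, 0 < r₂ ∧ ∀ r ∈ Set.Ioo 0 r₂, ∀ θ : ℝ → E3 → ℝ,
      IsSmoothSpaceTimeOn (Set.Icc (T - r ^ 2) (T - r ^ 2 / 2)) θ →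
      HasUniformRapidDecayOn (Set.Icc (T - r ^ 2) (T - r ^ 2 / 2)) θ →
      (∀ t ∈ Set.Icc (T - r ^ 2) (T - r ^ 2 / 2), ∀ x : E3,
        timeDerivWithin (Set.Icc (T - r ^ 2) (T - r ^ 2 / 2)) θ t x + inner ℝ (u t x) (gradient (θ t) x)
          = Laplacian.laplacian (θ t) x) →
      (∀ x, 0 ≤ θ (T - r ^ 2) x) → (∀ x, θ (T - r ^ 2) x ≤ 1) →
      (∀ x ∈ Metric.closedBall x₀ (r / 2), θ (T - r ^ 2) x = 1) →
      Function.support (θ (T - r ^ 2)) ⊆ Metric.ball x₀ r →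
      c₁ ^ 2 * ∫ x, (θ (T - r ^ 2) x) ^ 2 < ∫ x, (θ (T - r ^ 2 / 2) x) ^ 2 := by
  intro hF1 hF2 hF3 K hK
  -- the constant: a third of the Gaussian floor `λ(K)` of F3
  obtain ⟨lam, hlam, hfloor⟩ := hF3 K hK
  refine ⟨lam / 3, by positivity, ?_⟩
  intro T u p hT hcl x₀ hTI
  obtain ⟨r₁, hr₁, hTI⟩ := hTI
  -- the floor scale `r₂ = min (r₁/(4 + 8K)) √T`
  have hK4 : 0 < 4 + 8 * K := by positivity
  refine ⟨min (r₁ / (4 + 8 * K)) (Real.sqrt T), lt_min (by positivity) (Real.sqrt_pos.2 hT), ?_⟩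
  intro r hr θ hsm hdec hpde hθ0 hθ1 hone hsupp
  obtain ⟨hr, hrr₂⟩ := hr
  have hrK : r < r₁ / (4 + 8 * K) := hrr₂.trans_le (min_le_left _ _)
  have hrT' : r < Real.sqrt T := hrr₂.trans_le (min_le_right _ _)
  have hr4 : (4 + 8 * K) * r < r₁ := by
    rw [lt_div_iff₀ hK4] at hrK
    linarith
  have hKr : 0 ≤ K * r := by positivity
  have hrr₁ : r < r₁ := by nlinarith
  have h3r : (3 + 8 * K) * r < r₁ := by nlinarith
  have hrT : r ^ 2 < T := by
    have hsq : Real.sqrt T ^ 2 = T := Real.sq_sqrt hT.le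
    nlinarith [Real.sqrt_nonneg T]
  have hr2 : 0 < r ^ 2 := by positivity
  have hr12 : r ^ 2 < r₁ ^ 2 := by nlinarith
  -- (i) the window sits inside `[0, T)`: the drift is continuous on `S × ℝ³`
  have hSsub : Set.Icc (T - r ^ 2) (T - r ^ 2 / 2) ⊆ Set.Ico 0 T := fun t ht =>
    ⟨by linarith [ht.1], by linarith [ht.2]⟩
  have hcont : ContinuousOn (Function.uncurry u)
      (Set.Icc (T - r ^ 2) (T - r ^ 2 / 2) ×ˢ Set.univ) :=
    (hcl.smooth_velocity.mono hSsub).continuousOn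
  -- (ii) the Type-I bound gives the drift bound `√2 K / r` on `S × B(x₀, r₁)`
  have hbound : ∀ t ∈ Set.Icc (T - r ^ 2) (T - r ^ 2 / 2), ∀ x ∈ Metric.ball x₀ r₁,
      ‖u t x‖ ≤ Real.sqrt 2 * K / r := by
    intro t ht x hx
    have htI : t ∈ Set.Ioo (T - r₁ ^ 2) T := ⟨by linarith [ht.1], by linarith [ht.2]⟩
    exact typeIFloor_norm_le_of_typeI hr (by linarith [ht.2]) (hTI t htI x hx)
  -- (iii) F1: membership in the local drift–heat class over `U = B(x₀, r₁)`
  obtain ⟨a, ha⟩ := hF1 T r u θ hr hcont hsm hpde (Real.sqrt 2 * K / r) (Metric.ball x₀ r₁) hbound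
  -- (iv) F2: nonnegativity on the window
  have hpos : ∀ t ∈ Set.Icc (T - r ^ 2) (T - r ^ 2 / 2), ∀ x : E3, 0 ≤ θ t x :=
    hF2 T r u θ hr hsm hdec hpde hθ0
  -- (v) F3: the floor `λ` on `B̄(x₀, r/2)` at the final time
  have hsub : Metric.closedBall x₀ ((3 + 8 * K) * r) ⊆ Metric.ball x₀ r₁ :=
    closedBall_subset_ball h3r
  have hlow : ∀ x ∈ Metric.closedBall x₀ (r / 2), lam ≤ θ (T - r ^ 2 / 2) x :=
    hfloor a θ x₀ T r hr (Metric.ball x₀ r₁) isOpen_ball hsub ha hpos hone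
  -- (vi) integrability of the final squared slice
  have htS : T - r ^ 2 / 2 ∈ Set.Icc (T - r ^ 2) (T - r ^ 2 / 2) := ⟨by linarith, le_rfl⟩
  have hint : Integrable (fun x => (θ (T - r ^ 2 / 2) x) ^ 2) :=
    typeIFloor_integrable_sq_slice hsm hdec htS
  -- (vii) the `L²` accounting
  set V : ℝ := (volume : Measure E3).real (Metric.ball (0 : E3) 1) with hV
  have hV0 : 0 < V := by
    rw [hV, measureReal_def]
    exact ENNReal.toReal_pos (measure_ball_pos volume _ one_pos).ne' measure_ball_lt_top.ne
  have hI0 : ∫ x, (θ (T - r ^ 2) x) ^ 2 ≤ r ^ 3 * V :=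
    typeIFloor_integral_sq_le_of_bump hr.le hθ0 hθ1 hsupp
  have hI1 : lam ^ 2 * ((r / 2) ^ 3 * V) ≤ ∫ x, (θ (T - r ^ 2 / 2) x) ^ 2 :=
    typeIFloor_le_integral_sq_of_floor hr.le hlam.le hint hlow
  have hgap : 0 < lam ^ 2 * (r ^ 3 * V) := by positivity
  calc (lam / 3) ^ 2 * ∫ x, (θ (T - r ^ 2) x) ^ 2 ≤ (lam / 3) ^ 2 * (r ^ 3 * V) :=
        mul_le_mul_of_nonneg_left hI0 (sq_nonneg _)
    _ < lam ^ 2 * ((r / 2) ^ 3 * V) := by nlinarith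
    _ ≤ ∫ x, (θ (T - r ^ 2 / 2) x) ^ 2 := hI1

end Summit.NavierStokesRegularity.NavierStokesRegularity.Theorems

end
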